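import Mathlib

/-!
# Stub `laplace_cauchyKernel` (plan T2, component T2h) for crux `WeilComb.CombShapePositivity`
(item stmt-RiemannHypothesis-11229, route route-RiemannHypothesis-WeilComb, line `Sketch`,
stub-plan `Cruxes/CombShapePositivity/STUB-PLAN-stub_fejer.md`, tier T2 "dilation detection")

**Termwise Laplace transform in the dilation variable, with its closed form.** For a continuous
density `f : ℝ → ℂ` and complex `w, s` with `Re s > 2 |Re w|`,

  `∫_1^∞ (∫_{-2}^{2} f(t) e^{ε w t} dt) e^{-s ε} dε = ∫_{-2}^{2} f(t) · e^{w t - s} / (s - w t) dt`.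

The right-hand side is the Cauchy–Laplace kernel `K_f(w, s)` of the plan (holomorphic off the
segment `w · [-2, 2]`); in T2 it is applied with `f = ψ₀`, the continuous density of
`Φ₀(z)² = ∫_{-2}^{2} ψ₀(t) e^{z t} dt`, and `w = ρ - 1/2`.

Proof (Fubini on `[-2, 2] × (1, ∞)`): the integrand `(t, ε) ↦ f(t) e^{ε w t} e^{-s ε}` is
continuous and dominated on `Ι (-2) 2 × Ioi 1` by `C e^{-δ ε}` with `C = sup_{[-2,2]} ‖f‖`,
`δ = Re s - 2|Re w| > 0` (because `Re (ε w t - s ε) = ε (t Re w - Re s) ≤ -δ ε` for `|t| ≤ 2`,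
`ε ≥ 0`), which is integrable for the product of the two restricted Lebesgue measures; so the two
integrals may be swapped (`MeasureTheory.intervalIntegral_integral_swap`). The inner integral is
then `f(t) ∫_1^∞ e^{ε (w t - s)} dε = f(t) · (-e^{w t - s} / (w t - s))`
(`integral_exp_mul_complex_Ioi`, as `Re (w t - s) < 0`), which is the claimed kernel.
-/

noncomputable section

-- the sub-problem path RiemannHypothesis/RiemannHypothesis duplicates a namespace (D-0017)
set_option linter.dupNamespace false

open scoped BigOperators ComplexConjugate
open Complex MeasureTheory Set Filter

namespace Summit.RiemannHypothesis.RiemannHypothesis.Theorems.WeilCombBohrFejer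

/-- `-a / (b - c) = a / (c - b)`. [folklore] -/
private theorem neg_div_sub_eq (a b c : ℂ) : -a / (b - c) = a / (c - b) := by
  rw [← neg_div_neg_eq, neg_neg, neg_sub]

/-- Pointwise exponential bound: for `-2 < t ≤ 2` and `ε > 1`,
`‖e^{ε w t} e^{-s ε}‖ ≤ e^{-(Re s - 2|Re w|) ε}`. [folklore] -/
private theorem norm_cexp_mul_cexp_le (w s : ℂ) {t ε : ℝ} (ht : t ∈ Ioc (-2 : ℝ) 2)
    (hε : ε ∈ Ioi (1 : ℝ)) :
    ‖cexp ((ε : ℂ) * w * t) * cexp (-(s * ε))‖ ≤ Real.exp (-(s.re - 2 * |w.re|) * ε) := by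
  rw [norm_mul, Complex.norm_exp, Complex.norm_exp, ← Real.exp_add, Real.exp_le_exp]
  have hta : |t| ≤ 2 := abs_le.2 ⟨ht.1.le, ht.2⟩
  have h1 : w.re * t ≤ |w.re| * 2 :=
    calc w.re * t ≤ |w.re * t| := le_abs_self _
      _ = |w.re| * |t| := abs_mul _ _
      _ ≤ |w.re| * 2 := by gcongr
  have hε0 : 0 ≤ ε := (zero_lt_one.trans (mem_Ioi.1 hε)).le
  have h2 : ε * (w.re * t) ≤ ε * (|w.re| * 2) := mul_le_mul_of_nonneg_left h1 hε0
  simp only [mul_re, ofReal_re, ofReal_im, mul_zero, sub_zero, zero_mul, neg_re, mul_im,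
    add_zero]
  nlinarith [h2]

/-- **T2h `laplace_cauchyKernel`** (registered stub of crux stmt-RiemannHypothesis-11229, plan tier
T2): the Laplace transform in the dilation variable `ε` of `ε ↦ ∫_{-2}^{2} f(t) e^{ε w t} dt` on
`(1, ∞)` equals the Cauchy–Laplace kernel `∫_{-2}^{2} f(t) e^{w t - s} / (s - w t) dt` whenever
`Re s > 2 |Re w|` (Fubini, then `∫_1^∞ e^{ε c} dε = -e^{c}/c` for `Re c < 0`). [folklore] -/
theorem laplace_cauchyKernel : ∀ f : ℝ → ℂ, Continuous f → ∀ w s : ℂ, 2 * |w.re| < s.re →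
    ∫ ε in Set.Ioi (1 : ℝ), (∫ t in (-2 : ℝ)..2, f t * Complex.exp ((ε : ℂ) * w * t)) *
        Complex.exp (-(s * ε)) =
      ∫ t in (-2 : ℝ)..2, f t * Complex.exp (w * t - s) / (s - w * t) := by
  intro f hf w s hws
  -- notation: `δ = Re s - 2|Re w| > 0`, `C = sup_{[-2,2]} ‖f‖`
  have hδ : 0 < s.re - 2 * |w.re| := by linarith
  obtain ⟨C, hC⟩ : ∃ C, ∀ t ∈ Icc (-2 : ℝ) 2, ‖f t‖ ≤ C :=
    isCompact_Icc.exists_bound_of_continuousOn hf.continuousOn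
  have hC0 : 0 ≤ C := (norm_nonneg _).trans (hC 0 (by norm_num))
  -- pull the factor `e^{-s ε}` into the inner integral
  have h1 : (fun ε : ℝ => (∫ t in (-2 : ℝ)..2, f t * cexp ((ε : ℂ) * w * t)) * cexp (-(s * ε))) =
      fun ε : ℝ => ∫ t in (-2 : ℝ)..2, f t * cexp ((ε : ℂ) * w * t) * cexp (-(s * ε)) := by
    funext ε
    exact (intervalIntegral.integral_mul_const _ _).symm
  rw [h1]
  -- the integrand is integrable on `Ι (-2) 2 × Ioi 1` (dominated by `C e^{-δ ε}`)
  have hint : Integrable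
      (Function.uncurry fun (t ε : ℝ) => f t * cexp ((ε : ℂ) * w * t) * cexp (-(s * ε)))
      ((volume.restrict (uIoc (-2 : ℝ) 2)).prod (volume.restrict (Ioi (1 : ℝ)))) := by
    have hmeas : AEStronglyMeasurable
        (Function.uncurry fun (t ε : ℝ) => f t * cexp ((ε : ℂ) * w * t) * cexp (-(s * ε)))
        ((volume.restrict (uIoc (-2 : ℝ) 2)).prod (volume.restrict (Ioi (1 : ℝ)))) := by
      refine Continuous.aestronglyMeasurable ?_
      show Continuous fun p : ℝ × ℝ => f p.1 * cexp ((p.2 : ℂ) * w * p.1) * cexp (-(s * p.2))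
      fun_prop
    have hdom : Integrable (fun p : ℝ × ℝ => C * Real.exp (-(s.re - 2 * |w.re|) * p.2))
        ((volume.restrict (uIoc (-2 : ℝ) 2)).prod (volume.restrict (Ioi (1 : ℝ)))) := by
      refine Integrable.mul_prod (f := fun _ : ℝ => C)
        (g := fun ε : ℝ => Real.exp (-(s.re - 2 * |w.re|) * ε)) ?_ ?_
      · rw [uIoc_of_le (by norm_num)]
        exact integrable_const C
      · exact integrableOn_exp_mul_Ioi (by linarith) 1
    refine hdom.mono' hmeas ?_
    rw [Measure.prod_restrict, uIoc_of_le (by norm_num)]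
    refine (ae_restrict_iff' (measurableSet_Ioc.prod measurableSet_Ioi)).2 (ae_of_all _ ?_)
    rintro ⟨t, ε⟩ ⟨ht, hε⟩
    simp only [Function.uncurry_apply_pair]
    rw [mul_assoc, norm_mul]
    exact mul_le_mul (hC t (Ioc_subset_Icc_self ht)) (norm_cexp_mul_cexp_le w s ht hε)
      (norm_nonneg _) hC0
  -- Fubini
  rw [← intervalIntegral_integral_swap hint]
  -- the inner `ε`-integral in closed form
  refine intervalIntegral.integral_congr fun t ht => ?_
  rw [uIcc_of_le (by norm_num)] at ht
  have hta : |t| ≤ 2 := abs_le.2 ⟨ht.1, ht.2⟩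
  have hre : (w * t - s).re < 0 := by
    have h1 : w.re * t ≤ |w.re| * 2 :=
      calc w.re * t ≤ |w.re * t| := le_abs_self _
        _ = |w.re| * |t| := abs_mul _ _
        _ ≤ |w.re| * 2 := by gcongr
    simp only [sub_re, mul_re, ofReal_re, ofReal_im, mul_zero, sub_zero]
    linarith
  have h2 : (fun ε : ℝ => f t * cexp ((ε : ℂ) * w * t) * cexp (-(s * ε))) =
      fun ε : ℝ => f t * cexp ((w * t - s) * (ε : ℂ)) := by
    funext ε
    rw [mul_assoc, ← Complex.exp_add]
    congr 2
    ring
  simp only [h2]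
  rw [integral_const_mul, integral_exp_mul_complex_Ioi hre 1, ofReal_one, mul_one, neg_div_sub_eq,
    mul_div_assoc]

end Summit.RiemannHypothesis.RiemannHypothesis.Theorems.WeilCombBohrFejer

end
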